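import Mathlib

/-!
# `NoHeavyLowerTail` (crux stmt-CriticalPhenomena-4575), abstract sunflower cubic: THE OPEN PRODUCT OF A UNION-CLOSED FAMILY
# Part A — configurations, Möbius factors in the unit group, and the full Möbius product (FACT 1)

Support file (seat `prim-ineq-prove-1` gen 46; `--supports stmt-CriticalPhenomena-4575`).  Pure algebra in the ring
`MvPowerSeries A ℚ`; no `sorry`, no named facts.  Memo: run/shared/lean/prim/prim-ineq-prove-1/FINDING-PAR-prove1-g46.md §1.
This is the first of three files (`…OpenProduct`, `…OpenProductElim`, `…OpenProductPositivity`) proving (PAR):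
for every UNION-CLOSED family `𝒪` of subsets of a finite set, `1 - ∏_{S ∈ 𝒪} t_S` has nonnegative coefficients, where
`t_S = ∏_{B ⊆ S} (1 - ∑_{a∈B} x_a)^{(-1)^{#(S∖B)}}` — the combinatorial kernel behind the balancedness of the cost game of
every bipartite graph core (memo §2–§3).

SETTING.  `A` a type of "colours" (= variables).  A CONFIGURATION is a map `m : Finset A → MvPowerSeries A ℚ`
(`m C` = "the letters of colour `C`, counted by multidegree") with `m ∅ = 0`, zero constant terms and nonnegative
coefficients (`IsConfig`).  `y m B = ∑_{C ⊆ B} m C`, `U m B = 1 - y m B` (a unit), and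
    `T m S = ∏_{B ⊆ S} (U m B) ^ ((-1) ^ #(S \ B))`   (Möbius transform, in the group of units),
`F m 𝒪 = ∏_{S ∈ 𝒪} T m S`.
* `Nonneg`, `nonneg_inv_one_sub` (the geometric series of a nonnegative series is nonnegative), `unitOf`, `U`, `T`, `F`;
* `sum_sgn_Icc_eq`, `sum_sgn_Icc_eq'`: `∑_{X ⊆ B ⊆ Y} (-1)^{#(Y∖B)} = [X = Y]` and the dual sum;
* **`prod_T_powerset_univ`** (FACT 1): `∏_{S ⊆ univ} T m S = U m univ` (`∏_S ∏_{B⊆S} (1-y_B)^{±} = 1 - y_A`).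
-/

namespace Summit.CriticalPhenomena.PercolationContinuityZ3.Theorems.SunflowerPartition

namespace OpenProduct

open MvPowerSeries Finset

variable {A : Type*}

/-! ## Configurations -/

/-- `y m B = ∑_{C ⊆ B} m C`: the letters all of whose colours lie in `B`. [this work] -/
noncomputable def y (m : Finset A → MvPowerSeries A ℚ) (B : Finset A) : MvPowerSeries A ℚ :=
  ∑ C ∈ B.powerset, m C

/-- A configuration: `m ∅ = 0`, zero constant terms, nonnegative coefficients. [this work] -/
structure IsConfig (m : Finset A → MvPowerSeries A ℚ) : Prop where
  empty : m ∅ = 0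
  const : ∀ C, constantCoeff (m C) = 0
  nonneg : ∀ C (n : A →₀ ℕ), 0 ≤ coeff n (m C)

variable {m : Finset A → MvPowerSeries A ℚ}

/-- `y m ∅ = 0`. [this work] -/
theorem y_empty (hm : IsConfig m) : y m ∅ = 0 := by
  simp [y, hm.empty]

/-- `y m B` has no constant term. [this work] -/
theorem constantCoeff_y (hm : IsConfig m) (B : Finset A) : constantCoeff (y m B) = 0 := by
  simp [y, map_sum, hm.const]

/-- `y m B` has nonnegative coefficients. [this work] -/
theorem coeff_y_nonneg (hm : IsConfig m) (B : Finset A) (n : A →₀ ℕ) : 0 ≤ coeff n (y m B) := by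
  simp only [y, map_sum]
  exact sum_nonneg fun C _ => hm.nonneg C n

/-- `1 - y m B` has constant term `1`. [this work] -/
theorem constantCoeff_one_sub_y (hm : IsConfig m) (B : Finset A) : constantCoeff (1 - y m B) = 1 := by
  rw [map_sub, constantCoeff_y hm, map_one, sub_zero]

/-! ## Units -/

/-- A power series with constant coefficient `1`, bundled as a unit. [this work] -/
noncomputable def unitOf (φ : MvPowerSeries A ℚ) (h : constantCoeff φ = 1) : (MvPowerSeries A ℚ)ˣ :=
  ⟨φ, φ⁻¹, MvPowerSeries.mul_inv_cancel φ (by rw [h]; exact one_ne_zero),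
    MvPowerSeries.inv_mul_cancel φ (by rw [h]; exact one_ne_zero)⟩

/-- The value of `unitOf φ h` is `φ`. [this work] -/
@[simp] theorem val_unitOf (φ : MvPowerSeries A ℚ) (h : constantCoeff φ = 1) : (unitOf φ h : MvPowerSeries A ℚ) = φ :=
  rfl

/-- The value of `(unitOf φ h)⁻¹` is the power-series inverse `φ⁻¹`. [this work] -/
@[simp] theorem val_inv_unitOf (φ : MvPowerSeries A ℚ) (h : constantCoeff φ = 1) :
    ((unitOf φ h)⁻¹ : (MvPowerSeries A ℚ)ˣ) = (φ⁻¹ : MvPowerSeries A ℚ) :=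
  rfl

/-! ## Nonnegativity bookkeeping -/

/-- A power series with nonnegative (rational) coefficients. [this work] -/
def Nonneg (φ : MvPowerSeries A ℚ) : Prop := ∀ n : A →₀ ℕ, 0 ≤ coeff n φ

/-- Sums of nonnegative series are nonnegative. [this work] -/
theorem Nonneg.add {φ ψ : MvPowerSeries A ℚ} (hφ : Nonneg φ) (hψ : Nonneg ψ) : Nonneg (φ + ψ) := fun n => by
  rw [map_add]; exact add_nonneg (hφ n) (hψ n)

/-- Products of nonnegative series are nonnegative. [this work] -/
theorem Nonneg.mul [DecidableEq A] {φ ψ : MvPowerSeries A ℚ} (hφ : Nonneg φ) (hψ : Nonneg ψ) : Nonneg (φ * ψ) :=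
  fun n => by
  rw [coeff_mul]
  exact sum_nonneg fun x _ => mul_nonneg (hφ x.1) (hψ x.2)

/-- Finite sums of nonnegative series are nonnegative. [this work] -/
theorem Nonneg.sum {ι : Type*} (s : Finset ι) (f : ι → MvPowerSeries A ℚ) (h : ∀ i ∈ s, Nonneg (f i)) :
    Nonneg (∑ i ∈ s, f i) := fun n => by
  rw [map_sum]; exact sum_nonneg fun i hi => h i hi n

/-- `0` is nonnegative. [this work] -/
theorem nonneg_zero : Nonneg (0 : MvPowerSeries A ℚ) := fun n => by simp

/-- The geometric series `(1 - φ)⁻¹` of a nonnegative series without constant term is nonnegative. [this work] -/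
theorem nonneg_inv_one_sub [DecidableEq A] {φ : MvPowerSeries A ℚ} (h0 : constantCoeff φ = 0) (hφ : Nonneg φ) :
    Nonneg (1 - φ)⁻¹ := by
  have hc : constantCoeff (1 - φ) = 1 := by rw [map_sub, map_one, h0, sub_zero]
  intro n
  induction n using WellFoundedLT.induction with
  | ind n ih =>
    rw [coeff_inv]
    split_ifs with hn
    · rw [hc]; norm_num
    · rw [hc, inv_one, neg_one_mul, ← sum_neg_distrib]
      refine sum_nonneg fun x hx => ?_
      split_ifs with hx2
      · have hx1 : x.1 ≠ 0 := by
          intro h1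
          have := mem_antidiagonal.mp hx
          rw [h1, zero_add] at this
          exact (ne_of_lt hx2) this
        have : coeff x.1 (1 - φ) = -coeff x.1 φ := by
          rw [map_sub, coeff_one, if_neg hx1, zero_sub]
        rw [this, neg_mul, neg_neg]
        exact mul_nonneg (hφ x.1) (ih x.2 hx2)
      · simp

/-- `U m B = 1 - y m B` as a unit. [this work] -/
noncomputable def U (m : Finset A → MvPowerSeries A ℚ) (hm : IsConfig m) (B : Finset A) : (MvPowerSeries A ℚ)ˣ :=
  unitOf (1 - y m B) (constantCoeff_one_sub_y hm B)

/-- The value of the unit `U m B` is `1 - y m B`. [this work] -/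
@[simp] theorem val_U (hm : IsConfig m) (B : Finset A) : (U m hm B : MvPowerSeries A ℚ) = 1 - y m B := rfl

/-- `U m ∅ = 1`. [this work] -/
theorem U_empty (hm : IsConfig m) : U m hm ∅ = 1 := by
  ext; simp [y_empty hm]

variable [DecidableEq A]

/-- The sign `(-1) ^ #(S \ B)` as an integer exponent. [this work] -/
def sgn (B S : Finset A) : ℤ := (-1) ^ (S \ B).card

/-- `T m S = ∏_{B ⊆ S} (U m B) ^ ((-1) ^ #(S \ B))` (Möbius transform in the unit group). [this work] -/
noncomputable def T (m : Finset A → MvPowerSeries A ℚ) (hm : IsConfig m) (S : Finset A) : (MvPowerSeries A ℚ)ˣ :=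
  ∏ B ∈ S.powerset, U m hm B ^ sgn B S

/-- The product `F m 𝒪 = ∏_{S ∈ 𝒪} T m S` over a family of colour sets. [this work] -/
noncomputable def F (m : Finset A → MvPowerSeries A ℚ) (hm : IsConfig m) (𝒪 : Finset (Finset A)) :
    (MvPowerSeries A ℚ)ˣ :=
  ∏ S ∈ 𝒪, T m hm S

/-! ## Möbius exponent sums on the Boolean lattice -/

/-- `∑_{X ⊆ B ⊆ Y} (-1)^{#(Y \ B)} = [X = Y]`. [this work] -/
theorem sum_sgn_Icc_eq (X Y : Finset A) (hXY : X ⊆ Y) :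
    ∑ B ∈ Y.powerset with X ⊆ B, sgn B Y = if X = Y then 1 else 0 := by
  classical
  unfold sgn
  -- substitute `D = Y \ B`, which ranges over the subsets of `Y \ X`
  have key : ∑ B ∈ Y.powerset with X ⊆ B, ((-1 : ℤ) ^ (Y \ B).card) =
      ∑ D ∈ (Y \ X).powerset, (-1 : ℤ) ^ D.card := by
    refine Finset.sum_nbij' (fun B => Y \ B) (fun D => Y \ D) ?_ ?_ ?_ ?_ ?_
    · intro B hB
      simp only [mem_filter, mem_powerset] at hB
      simp only [mem_powerset]
      exact sdiff_subset_sdiff (Subset.refl _) hB.2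
    · intro D hD
      simp only [mem_powerset] at hD
      simp only [mem_filter, mem_powerset]
      refine ⟨sdiff_subset, ?_⟩
      intro a ha
      simp only [mem_sdiff]
      refine ⟨hXY ha, fun haD => ?_⟩
      have := hD haD
      simp only [mem_sdiff] at this
      exact this.2 ha
    · intro B hB
      simp only [mem_filter, mem_powerset] at hB
      simp only [sdiff_sdiff_right_self, inf_eq_inter, inter_eq_right.mpr hB.1]
    · intro D hD
      simp only [mem_powerset] at hD
      simp only [sdiff_sdiff_right_self, inf_eq_inter]
      exact inter_eq_right.mpr (hD.trans sdiff_subset)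
    · intro B hB
      rfl
  rw [key, Finset.sum_powerset_neg_one_pow_card]
  by_cases h : X = Y
  · subst h; simp
  · have : Y \ X ≠ ∅ := by
      intro h0
      apply h
      exact Subset.antisymm hXY (sdiff_eq_empty_iff_subset.mp h0)
    simp [h, this]

/-- `∑_{X ⊆ S ⊆ Y} (-1)^{#(S \ X)} = [X = Y]` (the dual sum, over supersets). [this work] -/
theorem sum_sgn_Icc_eq' (X Y : Finset A) (hXY : X ⊆ Y) :
    ∑ S ∈ Y.powerset with X ⊆ S, sgn X S = if X = Y then 1 else 0 := by
  classical
  unfold sgn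
  have key : ∑ S ∈ Y.powerset with X ⊆ S, ((-1 : ℤ) ^ (S \ X).card) =
      ∑ D ∈ (Y \ X).powerset, (-1 : ℤ) ^ D.card := by
    refine Finset.sum_nbij' (fun S => S \ X) (fun D => X ∪ D) ?_ ?_ ?_ ?_ ?_
    · intro S hS
      simp only [mem_filter, mem_powerset] at hS
      simp only [mem_powerset]
      exact sdiff_subset_sdiff hS.1 (Subset.refl _)
    · intro D hD
      simp only [mem_powerset] at hD
      simp only [mem_filter, mem_powerset]
      exact ⟨union_subset hXY (hD.trans sdiff_subset), subset_union_left⟩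
    · intro S hS
      simp only [mem_filter, mem_powerset] at hS
      exact union_sdiff_of_subset hS.2
    · intro D hD
      simp only [mem_powerset] at hD
      rw [union_sdiff_left]
      exact sdiff_eq_self_of_disjoint (disjoint_of_subset_left hD disjoint_sdiff_self_left)
    · intro S hS
      rfl
  rw [key, Finset.sum_powerset_neg_one_pow_card]
  by_cases h : X = Y
  · subst h; simp
  · have : Y \ X ≠ ∅ := by
      intro h0
      apply h
      exact Subset.antisymm hXY (sdiff_eq_empty_iff_subset.mp h0)
    simp [h, this]

/-- `∏_{i ∈ s} a ^ f i = a ^ ∑_{i ∈ s} f i` for integer exponents in a commutative group. [this work] -/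
theorem prod_zpow_eq_zpow_sum {G : Type*} [CommGroup G] {ι : Type*} (s : Finset ι) (f : ι → ℤ) (a : G) :
    ∏ i ∈ s, a ^ f i = a ^ ∑ i ∈ s, f i := by
  classical
  induction s using Finset.induction_on with
  | empty => simp
  | insert i s hi ih => rw [prod_insert hi, sum_insert hi, ih, zpow_add]

/-! ## FACT 1: the full Möbius product -/

section Fact1

variable [Fintype A]

/-- FACT 1: `∏_{S ⊆ univ} T m S = U m univ`, i.e. `∏_{S} ∏_{B ⊆ S} (1 - y_B)^{±} = 1 - y_A`. [this work] -/
theorem prod_T_powerset_univ (hm : IsConfig m) :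
    ∏ S ∈ (univ : Finset A).powerset, T m hm S = U m hm univ := by
  classical
  unfold T
  -- exchange the two products
  rw [Finset.prod_comm' (t' := (univ : Finset A).powerset)
        (s' := fun B => (univ : Finset A).powerset.filter fun S => B ⊆ S)
        (h := by
          intro S B
          simp only [mem_powerset, subset_univ, true_and, mem_filter, and_true])]
  -- now `∏_B ∏_{S ⊇ B} U B ^ sgn B S = ∏_B U B ^ (∑_{S ⊇ B} sgn B S)`
  simp_rw [prod_zpow_eq_zpow_sum]
  rw [← Finset.prod_erase_mul _ _ (mem_powerset.mpr (subset_univ (univ : Finset A)))]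
  rw [sum_sgn_Icc_eq' univ univ (Subset.refl _), if_pos rfl, zpow_one]
  rw [Finset.prod_eq_one, one_mul]
  intro B hB
  have hB' : B ≠ univ := (mem_erase.mp hB).1
  rw [sum_sgn_Icc_eq' B univ (subset_univ B), if_neg hB', zpow_zero]

end Fact1

end OpenProduct

end Summit.CriticalPhenomena.PercolationContinuityZ3.Theorems.SunflowerPartition
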